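import Literature.Geometry.Riemannian.GurskyEinsteinGapProofs
import Literature.Geometry.Riemannian.ChernGaussBonnetFourProofs
import Literature.Geometry.Riemannian.ChangGurskyYangRegularity
import Literature.Topology.FourManifolds.TrisectionEulerProofs
import HarnessLib

/-!
# Gursky's Einstein gap on homotopy `4`-spheres from the Weyl gap ALONE
(topic `Geometry/Riemannian`; the Chern–Gauss–Bonnet input of `GurskyEinsteinGapProofs.lean` discharged)

`GurskyEinsteinGapProofs.lean`, §3, reduces the named fact
`Literature.Geometry.Riemannian.gursky_einstein_homotopySphere_four` (Gursky 2000, Thm. 1 on `M ≃ₕ S⁴`: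
an Einstein metric `Ric = λ g`, `λ > 0`, has `W ≡ 0` or `vol ≤ 8π²/λ²`) to TWO orientation-free global
curvature inputs (`gursky_einstein_homotopySphere_four_of_chernGaussBonnet_of_weylGap`):

* (CGB) for such a metric, `∫|W|² dV + (8λ²/3) vol(M,g) = 64π²` — the Chern–Gauss–Bonnet formula at
  `χ(M ≃ₕ S⁴) = 2` with `r̊ = 0`, `s = 4λ`;
* (Gap) if `W ≢ 0` then `(16λ²/3) vol(M,g) ≤ ∫|W|² dV` — Gursky–LeBrun 1999, Thm. 1 and Cor. 1
  combined with the signature formula and `τ(M) = 0`.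

The first input is now a THEOREM: the general Chern–Gauss–Bonnet formula
`8π²χ(M) = ¼∫|W|² dV + ∫σ₂(A) dV` is proved in the tree (`chernGaussBonnet_four_holds`,
`ChernGaussBonnetFourProofs.lean`, Chern's intrinsic proof), `χ(M ≃ₕ S⁴) = 2`
(`finRelHomology_of_homotopyEquiv_sphere_four`), and for an Einstein metric `Ric = λ g` on a
`4`-dimensional model `σ₂(A) = −½|E|² + S²/24 = (4λ)²/24 = 2λ²/3` pointwise
(`sigma2WeylSchouten_eq`, `|E|² = |Ric|² − S²/4 = 4λ² − 4λ² = 0`). Hence: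

* `sigma2WeylSchouten_eq_of_ricci_eq_smul` — `σ₂(A_g)(x) = 2λ²/3` for `Ric = λ g` (dimension `4`);
* `weylEnergy_add_volume_eq_of_einstein_homotopySphere_four` — input (CGB), PROVED;
* `gursky_einstein_homotopySphere_four_of_weylGap` — **the fact from the Weyl gap alone**.

So the trust base of every consumer of `gursky_einstein_homotopySphere_four` (route
`SmoothPoincare4/EntropyRung`, crux `CompactShrinkerGap`, stmt-SmoothPoincare4-10870: the Einstein door
`Summit.….Theorems.helper_einsteinDoorReductionKillingHopf`) is the single statement (Gap), i.e.
Gursky–LeBrun's `W^±` gap plus Hirzebruch's signature theorem. No new definition, no new named fact.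

## References

* M. J. Gursky, *Four-manifolds with `δW⁺ = 0` and Einstein constants of the sphere*, Math. Ann. 318
  (2000) 417–431, Theorem 1. [Gursky2000]
* M. J. Gursky, C. LeBrun, Ann. Global Anal. Geom. 17 (1999) 315–328, §2 (gb)–(sig), §3, §5. [GurskyLebrun1999]
* A. L. Besse, *Einstein Manifolds* (1987), 6.31–6.32. [Besse1987]
* S.-Y. A. Chang, M. J. Gursky, P. C. Yang, Publ. Math. IHÉS 98 (2003), (1.1). [ChangGurskyYang2003]
-/

noncomputable section

open MeasureTheory Module
open scoped Manifold ContDiff ENNReal ContinuousMap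

namespace Literature.Geometry.Riemannian

open Literature.Geometry.Lorentzian (PseudoRiemannianMetric riemannianMeasure)
open Literature.Geometry.Lorentzian.PseudoRiemannianMetric
open Literature.AlgebraicTopology.SingularHomology (relEuler)

section Pointwise

variable {E : Type*} [NormedAddCommGroup E] [NormedSpace ℝ E] {H : Type*} [TopologicalSpace H]
  {I : ModelWithCorners ℝ E H} {M : Type*} [TopologicalSpace M] [ChartedSpace H M]
  [IsManifold I ∞ M] [FiniteDimensional ℝ E] [CompleteSpace E]
  (g : PseudoRiemannianMetric I ∞ E (TangentSpace I : M → Type _)) [g.HasLeviCivita]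

/-- **`σ₂(A) = 2λ²/3` for an Einstein metric `Ric = λ g` in dimension `4`** (Besse 1987, 6.31–6.32:
`σ₂(A) = −½|r̊|² + s²/24` with `r̊ = 0`, `s = 4λ`; Chang–Gursky–Yang 2003, (1.1)): in a `g_x`-orthonormal
`4`-frame `e`, `Ric(eᵢ,eⱼ) = λδᵢⱼ`, so `S = Σᵢ Ric(eᵢ,eᵢ) = 4λ`, `|Ric|² = Σᵢⱼ Ric(eᵢ,eⱼ)² = 4λ²`,
`|E|² = |Ric|² − S²/4 = 0` and `σ₂(A) = −½|E|² + S²/24 = 2λ²/3`. [cite: Besse1987, 6.31 and 6.32] -/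
theorem _root_.Literature.Geometry.Lorentzian.PseudoRiemannianMetric.sigma2WeylSchouten_eq_of_ricci_eq_smul
    (hg : g.IsRiemannian) (hE : finrank ℝ E = 4) {lam : ℝ}
    (hRic : ∀ (x : M) (X Y : TangentSpace I x), g.ricci x X Y = lam * g.val x X Y) (x : M) :
    g.sigma2WeylSchouten x = 2 * lam ^ 2 / 3 := by
  obtain ⟨b, hb⟩ := g.exists_basis_isOrthonormalFrame (x := x) (fun v hv ↦ hg x v hv) hE
  -- the scalar curvature `S = Σᵢ Ric(bᵢ,bᵢ) = 4λ`
  have hS : g.scalarCurvature x = 4 * lam := by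
    rw [← hb.sum_ricci_eq_scalarCurvature g hE]
    simp only [hRic, hb.1, mul_one, Finset.sum_const, Finset.card_univ, Fintype.card_fin,
      nsmul_eq_mul]
    push_cast
    ring
  -- `|Ric|² = Σᵢⱼ Ric(bᵢ,bⱼ)² = 4λ²`
  have hRicSq : g.normSq x (g.ricci x) = 4 * lam ^ 2 := by
    rw [← g.ricciNormSqFrame_eq_normSq hb (by rw [Fintype.card_fin, hE])]
    simp only [ricciNormSqFrame, hRic]
    have hval : ∀ i j : Fin 4, g.val x (b i) (b j) = if i = j then 1 else 0 := fun i j ↦ by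
      by_cases hij : i = j
      · subst hij; simp [hb.1 i]
      · simp [hij, hb.2 i j hij]
    simp only [hval, mul_ite, mul_one, mul_zero, ite_pow, ne_eq, OfNat.ofNat_ne_zero,
      not_false_eq_true, zero_pow, Finset.sum_ite_eq, Finset.mem_univ, if_true, Finset.sum_const,
      Finset.card_univ, Fintype.card_fin, nsmul_eq_mul]
    push_cast
    ring
  rw [g.sigma2WeylSchouten_eq (WithTop.coe_le_coe.mpr le_top) hE (fun v hv ↦ hg x v hv),
    g.tracelessRicciNormSq_eq_normSq hg hE x, hRicSq, hS]
  ring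

end Pointwise

/-- **Input (CGB) of `gursky_einstein_homotopySphere_four_of_chernGaussBonnet_of_weylGap`, PROVED**:
for a closed smooth `M ≃ₕ S⁴` and a smooth Riemannian Einstein metric `Ric = λ g`, `λ > 0` (with its
Levi-Civita connection), `∫|W|² dV + (8λ²/3) vol(M,g) = 64π²` in `ℝ≥0∞` (`(0,4)`-norm Weyl energy of
`WeylEnergy.lean`, Riemannian measure of `Volume.lean`). Proof: the Chern–Gauss–Bonnet theorem of the tree
(`chernGaussBonnet_four_holds`: `8π²χ = ¼(∫|W|²).toReal + ∫σ₂`), `χ = 2`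
(`finRelHomology_of_homotopyEquiv_sphere_four`), `σ₂ ≡ 2λ²/3` (`sigma2WeylSchouten_eq_of_ricci_eq_smul`)
so that `∫σ₂ = (2λ²/3)·vol.toReal`, and finiteness of both the Weyl energy (`weylEnergy_lt_top`) and the
volume of the compact manifold to return to `ℝ≥0∞`. [cite: Besse1987, 6.31 and 6.32]
[cite: GurskyLebrun1999, §2 (gb)] -/
theorem weylEnergy_add_volume_eq_of_einstein_homotopySphere_four
    (M : Type) [TopologicalSpace M] [T2Space M] [SecondCountableTopology M]
    [ChartedSpace (EuclideanSpace ℝ (Fin 4)) M] [IsManifold (𝓡 4) ∞ M] [CompactSpace M]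
    [T3Space M] [MeasurableSpace M] [BorelSpace M]
    (e : M ≃ₕ Metric.sphere (0 : EuclideanSpace ℝ (Fin 5)) 1)
    (g : PseudoRiemannianMetric (𝓡 4) ∞ (EuclideanSpace ℝ (Fin 4)) (TangentSpace (𝓡 4) : M → Type _))
    [g.HasLeviCivita] (hg : g.IsRiemannian) (lam : ℝ) (_hlam : 0 < lam)
    (hRic : ∀ (x : M) (X Y : TangentSpace (𝓡 4) x), g.ricci x X Y = lam * g.val x X Y) :
    g.weylEnergy + ENNReal.ofReal (8 * lam ^ 2 / 3) *
        riemannianMeasure (g.toContMDiffRiemannianMetric hg) Set.univ =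
      ENNReal.ofReal (64 * Real.pi ^ 2) := by
  have hE : finrank ℝ (EuclideanSpace ℝ (Fin 4)) = 4 := finrank_euclideanSpace_fin
  -- Chern–Gauss–Bonnet with `χ = 2`
  have hχ : relEuler ℤ ℤ M ∅ = 2 :=
    (Literature.Topology.FourManifolds.finRelHomology_of_homotopyEquiv_sphere_four e).2
  have hCGB := chernGaussBonnet_four_holds M g hg
  rw [hχ] at hCGB
  push_cast at hCGB
  -- `∫σ₂ dV = (2λ²/3) · vol`
  set μ := riemannianMeasure (g.toContMDiffRiemannianMetric hg) with hμ
  haveI : IsFiniteMeasure μ :=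
    ⟨Lorentzian.riemannianVolume_lt_top_of_isCompact_holds (g.toContMDiffRiemannianMetric hg) le_rfl
      isCompact_univ⟩
  have hσ : g.sigma2WeylSchoutenIntegral = 2 * lam ^ 2 / 3 * (μ Set.univ).toReal := by
    rw [g.sigma2WeylSchoutenIntegral_eq hg, ← hμ,
      integral_congr_ae (ae_of_all _ (g.sigma2WeylSchouten_eq_of_ricci_eq_smul hg hE hRic)),
      integral_const, smul_eq_mul, Measure.real, mul_comm]
  rw [hσ] at hCGB
  -- back to `ℝ≥0∞`: both summands are finite
  have hWtop : g.weylEnergy ≠ ⊤ := (g.weylEnergy_lt_top hg).ne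
  have hVtop : μ Set.univ ≠ ⊤ := (measure_lt_top μ _).ne
  have hWreal : g.weylEnergy.toReal = 64 * Real.pi ^ 2 - 8 * lam ^ 2 / 3 * (μ Set.univ).toReal := by
    linarith
  have hnonneg : 0 ≤ 64 * Real.pi ^ 2 - 8 * lam ^ 2 / 3 * (μ Set.univ).toReal := by
    rw [← hWreal]; exact ENNReal.toReal_nonneg
  calc g.weylEnergy + ENNReal.ofReal (8 * lam ^ 2 / 3) * μ Set.univ
      = ENNReal.ofReal (g.weylEnergy.toReal) +
          ENNReal.ofReal (8 * lam ^ 2 / 3) * ENNReal.ofReal ((μ Set.univ).toReal) := by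
        rw [ENNReal.ofReal_toReal hWtop, ENNReal.ofReal_toReal hVtop]
    _ = ENNReal.ofReal (64 * Real.pi ^ 2 - 8 * lam ^ 2 / 3 * (μ Set.univ).toReal) +
          ENNReal.ofReal (8 * lam ^ 2 / 3 * (μ Set.univ).toReal) := by
        rw [hWreal, ← ENNReal.ofReal_mul (by positivity)]
    _ = ENNReal.ofReal (64 * Real.pi ^ 2 - 8 * lam ^ 2 / 3 * (μ Set.univ).toReal +
          8 * lam ^ 2 / 3 * (μ Set.univ).toReal) :=
        (ENNReal.ofReal_add hnonneg (by positivity)).symm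
    _ = ENNReal.ofReal (64 * Real.pi ^ 2) := by congr 1; ring

/-- **Gursky's gap `gursky_einstein_homotopySphere_four` from the Weyl gap ALONE.** The only remaining
input is, orientation-free: for every closed smooth `M ≃ₕ S⁴` and every smooth Riemannian Einstein metric
`Ric = λ g`, `λ > 0`, with some nonzero orthonormal-frame Weyl component somewhere,
`(16λ²/3) vol(M,g) ≤ ∫|W|² dV` — Gursky–LeBrun 1999, Thm. 1 (`W⁺ ≢ 0 ⟹ ∫|W⁺|² ≥ ∫s²/24`) and its
mirror Cor. 1, added over an orientation with `∫|W⁺|² = ∫|W⁻|²` (signature formula, `τ(M ≃ₕ S⁴) = 0`)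
and `|W|²_{(0,4)} = 4(|W⁺|² + |W⁻|²)`. The Chern–Gauss–Bonnet input of
`gursky_einstein_homotopySphere_four_of_chernGaussBonnet_of_weylGap` is supplied by
`weylEnergy_add_volume_eq_of_einstein_homotopySphere_four`. [cite: Gursky2000, Theorem 1]
[cite: GurskyLebrun1999, §3 Thm. 1 and Cor. 1, §5] -/
theorem gursky_einstein_homotopySphere_four_of_weylGap
    (hGap : ∀ (M : Type) [TopologicalSpace M] [T2Space M] [SecondCountableTopology M]
      [ChartedSpace (EuclideanSpace ℝ (Fin 4)) M] [IsManifold (𝓡 4) ∞ M] [CompactSpace M]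
      [T3Space M] [MeasurableSpace M] [BorelSpace M],
      M ≃ₕ Metric.sphere (0 : EuclideanSpace ℝ (Fin 5)) 1 →
      ∀ (g : PseudoRiemannianMetric (𝓡 4) ∞ (EuclideanSpace ℝ (Fin 4))
          (TangentSpace (𝓡 4) : M → Type _))
        [g.HasLeviCivita] (hg : g.IsRiemannian) (lam : ℝ), 0 < lam →
        (∀ (x : M) (X Y : TangentSpace (𝓡 4) x), g.ricci x X Y = lam * g.val x X Y) →
        (∃ (x : M) (e : Fin 4 → TangentSpace (𝓡 4) x), g.IsOrthonormalFrame x e ∧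
            ∃ i j k l, g.weylFrame x e i j k l ≠ 0) →
        ENNReal.ofReal (16 * lam ^ 2 / 3) *
            riemannianMeasure (g.toContMDiffRiemannianMetric hg) Set.univ ≤ g.weylEnergy) :
    gursky_einstein_homotopySphere_four :=
  gursky_einstein_homotopySphere_four_of_chernGaussBonnet_of_weylGap
    (fun M _ _ _ _ _ _ _ _ _ e g _ hg lam hlam hRic ↦
      weylEnergy_add_volume_eq_of_einstein_homotopySphere_four M e g hg lam hlam hRic) hGap

end Literature.Geometry.Riemannian

end
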